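import Summits.AtomisticToContinuum.Crystallization.Theorems.ChargedEnergyGapResidualSF
import HarnessLib

/-!
# Charged energy gap — lens-3 g64, node «BarlowRef» (R3) — part 7 (independent): the FRACTIONAL-ASSIGNMENT (block Fubini) lemma of P-Z₅d

Imports only the tree (`…ResidualSF`).  ELEMENTARY·PROVED, pure finite double counting — the assembly step of the block scheme (memo g64 §3 step 2):
pairs `p` carry weights `w p ≥ 0`; each pair is assigned SHARES `σ p c ≥ 0` over carriers `c` summing to `1` (uniform shares `1/#B(p)` over a
block `B(p)` of `≥ N` members being the case of record); if every carrier's LOAD `Σ_p σ p c · w p` is within its BUDGET `β c`, then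
`Σ_p w p ≤ Σ_c β c`.

* ★ `sum_le_sum_budget_of_shares` — general shares;
* ★ `sum_le_sum_budget_of_blocks` — uniform shares over blocks `B p ⊆ carriers` with `N ≤ #B(p)` and per-carrier load `Σ_{p : c ∈ B p} w p ≤ N · β c`;
* `sum_le_sum_budget_of_blocks'` — the same with the load hypothesis stated through an upper bound `L c` (`load ≤ L c ≤ N β c`), the form in
  which `TubeShareBoundH` (part 6: `load ≤ θ · #block`) is consumed: `θ · N_c ≤ N · β c` whenever `θ · (#B/N) ≤ β c`.

0 sorry; standard axioms.
-/

noncomputable section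

open scoped Classical

namespace Summit.AtomisticToContinuum.Crystallization.Theorems.ChargedEnergyGapChartDial

section BlockFubini

variable {π κ : Type*}

/-- ★ FRACTIONAL ASSIGNMENT, general shares: `σ p c ≥ 0`, `Σ_{c ∈ Car} σ p c = 1` for every pair, and every carrier within budget
`Σ_{p ∈ Pairs} σ p c * w p ≤ β c` ⟹ `Σ_p w p ≤ Σ_c β c`. -/
theorem sum_le_sum_budget_of_shares (Pairs : Finset π) (Car : Finset κ) (w : π → ℝ) (σ : π → κ → ℝ) (β : κ → ℝ)
    (hσ1 : ∀ p ∈ Pairs, ∑ c ∈ Car, σ p c = 1)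
    (hload : ∀ c ∈ Car, ∑ p ∈ Pairs, σ p c * w p ≤ β c) :
    ∑ p ∈ Pairs, w p ≤ ∑ c ∈ Car, β c := by
  calc ∑ p ∈ Pairs, w p = ∑ p ∈ Pairs, ∑ c ∈ Car, σ p c * w p := by
        refine Finset.sum_congr rfl fun p hp => ?_
        rw [← Finset.sum_mul, hσ1 p hp, one_mul]
    _ = ∑ c ∈ Car, ∑ p ∈ Pairs, σ p c * w p := Finset.sum_comm
    _ ≤ ∑ c ∈ Car, β c := Finset.sum_le_sum hload

/-- ★ FRACTIONAL ASSIGNMENT, uniform shares over blocks: every pair `p` has a block `B p ⊆ Car` of at least `N ≥ 1` carriers, weights are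
non-negative, and every carrier's load `Σ_{p : c ∈ B p} w p ≤ N · β c` ⟹ `Σ_p w p ≤ Σ_c β c`. -/
theorem sum_le_sum_budget_of_blocks (Pairs : Finset π) (Car : Finset κ) (B : π → Finset κ) (w : π → ℝ) (β : κ → ℝ) {N : ℕ} (hN : 0 < N)
    (hw : ∀ p ∈ Pairs, 0 ≤ w p) (hB : ∀ p ∈ Pairs, B p ⊆ Car) (hcard : ∀ p ∈ Pairs, N ≤ (B p).card)
    (hload : ∀ c ∈ Car, ∑ p ∈ Pairs with c ∈ B p, w p ≤ N * β c) :
    ∑ p ∈ Pairs, w p ≤ ∑ c ∈ Car, β c := by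
  have hN' : (0 : ℝ) < N := by exact_mod_cast hN
  -- shares σ p c = [c ∈ B p] / #B(p) would do; we run the uniform computation directly with the weaker normalisation 1/N.
  have h1 : ∀ p ∈ Pairs, w p ≤ ∑ c ∈ Car, (if c ∈ B p then w p / N else 0) := by
    intro p hp
    rw [Finset.sum_ite_mem, Finset.inter_eq_right.2 (hB p hp), Finset.sum_const, nsmul_eq_mul]
    have hc : (N : ℝ) ≤ (B p).card := by exact_mod_cast hcard p hp
    have := hw p hp
    rw [mul_div_assoc']
    exact (le_div_iff₀ hN').2 (by nlinarith)
  calc ∑ p ∈ Pairs, w p ≤ ∑ p ∈ Pairs, ∑ c ∈ Car, (if c ∈ B p then w p / N else 0) := Finset.sum_le_sum h1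
    _ = ∑ c ∈ Car, ∑ p ∈ Pairs, (if c ∈ B p then w p / N else 0) := Finset.sum_comm
    _ = ∑ c ∈ Car, (∑ p ∈ Pairs with c ∈ B p, w p) / N := by
        refine Finset.sum_congr rfl fun c _ => ?_
        rw [Finset.sum_filter, Finset.sum_div]
        exact Finset.sum_congr rfl fun p _ => by split_ifs <;> simp
    _ ≤ ∑ c ∈ Car, β c := Finset.sum_le_sum fun c hc => by
        rw [div_le_iff₀ hN']
        linarith [hload c hc]

/-- The same with the per-carrier load bounded through an intermediate `L c` (e.g. `θ · #(P.points ∩ B̄(q, R))` from `TubeShareBoundH`) and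
`L c ≤ N · β c`. -/
theorem sum_le_sum_budget_of_blocks' (Pairs : Finset π) (Car : Finset κ) (B : π → Finset κ) (w : π → ℝ) (β L : κ → ℝ) {N : ℕ} (hN : 0 < N)
    (hw : ∀ p ∈ Pairs, 0 ≤ w p) (hB : ∀ p ∈ Pairs, B p ⊆ Car) (hcard : ∀ p ∈ Pairs, N ≤ (B p).card)
    (hload : ∀ c ∈ Car, ∑ p ∈ Pairs with c ∈ B p, w p ≤ L c) (hL : ∀ c ∈ Car, L c ≤ N * β c) :
    ∑ p ∈ Pairs, w p ≤ ∑ c ∈ Car, β c :=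
  sum_le_sum_budget_of_blocks Pairs Car B w β hN hw hB hcard fun c hc => (hload c hc).trans (hL c hc)

/-- BUDGET SPLIT: if the carriers' budgets are `β c = B_T · t c + B_χ · x c + B_H · n c` (tension mass, transition mass, priced-near indicator),
the conclusion reads `Σ_p w p ≤ B_T Σ t + B_χ Σ x + B_H Σ n` — the shape of `BulkFarResidueBoundB`'s right-hand side. [formal bookkeeping] -/
theorem sum_budget_split (Car : Finset κ) (t x n : κ → ℝ) (B_T B_χ B_H : ℝ) :
    ∑ c ∈ Car, (B_T * t c + B_χ * x c + B_H * n c) = B_T * ∑ c ∈ Car, t c + B_χ * ∑ c ∈ Car, x c + B_H * ∑ c ∈ Car, n c := by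
  rw [Finset.sum_add_distrib, Finset.sum_add_distrib, Finset.mul_sum, Finset.mul_sum, Finset.mul_sum]

end BlockFubini

end Summit.AtomisticToContinuum.Crystallization.Theorems.ChargedEnergyGapChartDial

end
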